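import Mathlib
import HarnessLib

/-!
# Stub `stub_cycleBalancing` of line `birth` (crux `ContractivityPrice.PriceOfContractivity`,
item stmt-ValiantsHypothesis-10583)

**Max-plus balancing (Lemma 1 of the cycle bound).** Let `K` be an `R × R` complex matrix and
`M > 0`. If every directed cycle `v 0 → v 1 → ⋯ → v n → v 0` through distinct vertices (loops
included) has `‖∏ K (v t) (v (t+1))‖ ≤ M ^ (n+1)`, then there are positive weights `d` with
`d i * ‖K i j‖ / d j ≤ M` for all `i j`, i.e. the diagonal similarity `D K D⁻¹` has all entries of
modulus `≤ M`.

Proof (potentials = best path values, no logarithms). Normalise the edge weights to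
`w i j := ‖K i j‖ / M ≥ 0`; the hypothesis says every cycle through distinct vertices has
`∏ w ≤ 1` (`prod_norm_div_cycle_le_one`). A PATH starting at `i` is an injective
`q : Fin (k+1) → Fin R` with `q 0 = i`; its value is `∏ t : Fin k, w (q t.castSucc) (q t.succ)`
(empty product `1` for `k = 0`). Injectivity forces `k < R`, so the set of values of paths starting
at `i` is finite and contains `1`; let `e i` be its maximum (`sSup`), so `1 ≤ e i`.
CLAIM `e j * w i j ≤ e i` (`exists_potential`): take an optimal path `q` from `j`.
* If `i ∉ range q`, then `Fin.cons i q` is a path from `i` of value `w i j * e j`, hence `≤ e i`.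
* If `i = q n`, the prefix `q 0, …, q n` closed up by the edge `q n = i → j = q 0` is a cycle
  through distinct vertices, so `(∏_{t<n} w (q t) (q (t+1))) * w i j ≤ 1`
  (`prefix_mul_closing_le_one`), while the suffix `q n, …, q k` is a path from `i`, of value
  `≤ e i`; splitting the value of `q` at `n` (`Fin.prod_univ_add`) gives
  `e j * w i j ≤ (suffix value) ≤ e i`.
Finally `d i := (e i)⁻¹` works: `d i * ‖K i j‖ / d j = e j * ‖K i j‖ / e i ≤ M`.
(`R = 0` needs no special treatment: all statements over `Fin 0` are vacuous.)

No definitions; pure theorem file serving the lead's skeleton `work/PriceOfContractivity.lean`.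
-/

-- D-0017: a single-problem summit is `Summits/<S>/<S>/…` with namespace `Summit.<S>.<S>.…`
-- by design.
set_option linter.dupNamespace false

namespace Summit.ValiantsHypothesis.ValiantsHypothesis.Theorems.PriceOfContractivity.CycleBalancing

/-- **Normalised cycle bound.** If every cycle through distinct vertices has
`‖∏ K (v t) (v (t+1))‖ ≤ M ^ (n+1)` (`M > 0`), then in the normalised weights `‖K i j‖ / M` every
such cycle has product `≤ 1`. [folklore] -/
theorem prod_norm_div_cycle_le_one {R : ℕ} (K : Matrix (Fin R) (Fin R) ℂ) {M : ℝ} (hM : 0 < M)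
    (hcyc : ∀ (n : ℕ) (v : Fin (n + 1) → Fin R), Function.Injective v →
      ‖∏ t : Fin (n + 1), K (v t) (v (t + 1))‖ ≤ M ^ (n + 1))
    {n : ℕ} (v : Fin (n + 1) → Fin R) (hv : Function.Injective v) :
    ∏ t : Fin (n + 1), ‖K (v t) (v (t + 1))‖ / M ≤ 1 := by
  rw [Finset.prod_div_distrib, Fin.prod_const, div_le_one₀ (pow_pos hM _), ← Complex.norm_prod]
  exact hcyc n v hv

/-- **Closing a path prefix into a cycle.** If every cycle through distinct vertices has weight
product `≤ 1` and `q : Fin (k+1) → Fin R` is injective, then for `n ≤ k` the prefix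
`q 0 → q 1 → ⋯ → q n` closed up by the edge `q n → q 0` is such a cycle, so
`(∏_{t<n} w (q t) (q (t+1))) * w (q n) (q 0) ≤ 1`. [folklore] -/
theorem prefix_mul_closing_le_one {R : ℕ} (w : Fin R → Fin R → ℝ)
    (hw : ∀ (n : ℕ) (v : Fin (n + 1) → Fin R), Function.Injective v →
      ∏ t : Fin (n + 1), w (v t) (v (t + 1)) ≤ 1)
    {k : ℕ} (q : Fin (k + 1) → Fin R) (hq : Function.Injective q) (n : ℕ) (hn : n ≤ k) :
    (∏ t : Fin n, w (q ⟨t, by omega⟩) (q ⟨t + 1, by omega⟩)) * w (q ⟨n, by omega⟩) (q 0) ≤ 1 := by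
  have h := hw n (fun t => q ⟨t, by omega⟩)
    (fun a b hab => Fin.ext (Fin.mk.inj_iff.mp (hq hab)))
  simp only [Fin.prod_univ_castSucc, Fin.coeSucc_eq_succ, Fin.last_add_one, Fin.val_castSucc,
    Fin.val_succ, Fin.val_last, Fin.val_zero, Fin.zero_eta] at h
  exact h

/-- **Max-plus potentials.** For nonnegative weights `w` on the complete digraph on `Fin R` such
that every cycle through distinct vertices has `∏ w ≤ 1`, there are potentials `e ≥ 1` with
`e j * w i j ≤ e i` for all `i j`: `e i` is the largest value `∏ w` of a path through distinct
vertices starting at `i`. [folklore] -/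
theorem exists_potential {R : ℕ} (w : Fin R → Fin R → ℝ) (hw0 : ∀ i j, 0 ≤ w i j)
    (hw : ∀ (n : ℕ) (v : Fin (n + 1) → Fin R), Function.Injective v →
      ∏ t : Fin (n + 1), w (v t) (v (t + 1)) ≤ 1) :
    ∃ e : Fin R → ℝ, (∀ i, 1 ≤ e i) ∧ ∀ i j, e j * w i j ≤ e i := by
  -- `S i`: the values of the paths through distinct vertices starting at `i`.
  obtain ⟨S, hS⟩ : ∃ S : Fin R → Set ℝ, ∀ i x, x ∈ S i ↔ ∃ (k : ℕ) (q : Fin (k + 1) → Fin R),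
      Function.Injective q ∧ q 0 = i ∧ ∏ t : Fin k, w (q t.castSucc) (q t.succ) = x :=
    ⟨fun i => {x | ∃ (k : ℕ) (q : Fin (k + 1) → Fin R),
      Function.Injective q ∧ q 0 = i ∧ ∏ t : Fin k, w (q t.castSucc) (q t.succ) = x},
      fun _ _ => Iff.rfl⟩
  have hfin : ∀ i, (S i).Finite := by
    intro i
    refine Set.Finite.subset (Set.finite_iUnion fun k : Fin R => Set.finite_range
      (fun q : Fin (k.val + 1) → Fin R => ∏ t : Fin k.val, w (q t.castSucc) (q t.succ))) ?_
    intro x hx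
    obtain ⟨k, q, hq, -, rfl⟩ := (hS i x).mp hx
    have hk : k < R := by
      have := Fintype.card_le_of_injective q hq
      simp only [Fintype.card_fin] at this
      omega
    exact Set.mem_iUnion.mpr ⟨⟨k, hk⟩, q, rfl⟩
  have hone : ∀ i, (1 : ℝ) ∈ S i := fun i =>
    (hS i 1).mpr
      ⟨0, fun _ => i, fun a b _ => Subsingleton.elim (α := Fin 1) a b, rfl, Fin.prod_univ_zero _⟩
  have hle : ∀ {k : ℕ} (q : Fin (k + 1) → Fin R), Function.Injective q →
      ∏ t : Fin k, w (q t.castSucc) (q t.succ) ≤ sSup (S (q 0)) := fun q hq =>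
    le_csSup (hfin _).bddAbove ((hS _ _).mpr ⟨_, q, hq, rfl, rfl⟩)
  refine ⟨fun i => sSup (S i), fun i => le_csSup (hfin i).bddAbove (hone i), fun i j => ?_⟩
  -- an optimal path `q` from `j`
  obtain ⟨k, q, hq, hq0, hqv⟩ := (hS j _).mp (Set.Nonempty.csSup_mem ⟨1, hone j⟩ (hfin j))
  suffices key : (∏ t : Fin k, w (q t.castSucc) (q t.succ)) * w i j ≤ sSup (S i) by
    rwa [hqv] at key
  by_cases hi : i ∈ Set.range q
  · -- `i = q n`: close the prefix into a cycle, keep the suffix as a path from `i`.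
    obtain ⟨⟨n, hn⟩, hs⟩ := hi
    obtain ⟨m, rfl⟩ : ∃ m, k = n + m := Nat.exists_eq_add_of_le (by omega)
    have hclose := prefix_mul_closing_le_one w hw q hq n (by omega)
    rw [hs, hq0] at hclose
    have hsuf := hle (fun t : Fin (m + 1) => q ⟨n + t.val, by omega⟩)
      (fun a b hab => Fin.ext (Nat.add_left_cancel (Fin.mk.inj_iff.mp (hq hab))))
    simp only [Fin.val_castSucc, Fin.val_succ, Fin.val_zero, Nat.add_zero, hs] at hsuf
    have hP : (∏ t : Fin n, w (q (Fin.castAdd m t).castSucc) (q (Fin.castAdd m t).succ)) =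
        ∏ t : Fin n, w (q ⟨t, by omega⟩) (q ⟨t + 1, by omega⟩) :=
      Finset.prod_congr rfl fun t _ => rfl
    have hQ : (∏ t : Fin m, w (q (Fin.natAdd n t).castSucc) (q (Fin.natAdd n t).succ)) =
        ∏ t : Fin m, w (q ⟨n + t.val, by omega⟩) (q ⟨n + (t.val + 1), by omega⟩) :=
      Finset.prod_congr rfl fun t _ => rfl
    rw [Fin.prod_univ_add, hP, hQ]
    calc (∏ t : Fin n, w (q ⟨t, by omega⟩) (q ⟨t + 1, by omega⟩)) *
          (∏ t : Fin m, w (q ⟨n + t.val, by omega⟩) (q ⟨n + (t.val + 1), by omega⟩)) * w i j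
        = (∏ t : Fin n, w (q ⟨t, by omega⟩) (q ⟨t + 1, by omega⟩)) * w i j *
            ∏ t : Fin m, w (q ⟨n + t.val, by omega⟩) (q ⟨n + (t.val + 1), by omega⟩) := by
          ring
      _ ≤ ∏ t : Fin m, w (q ⟨n + t.val, by omega⟩) (q ⟨n + (t.val + 1), by omega⟩) :=
          mul_le_of_le_one_left (Finset.prod_nonneg fun t _ => hw0 _ _) hclose
      _ ≤ sSup (S i) := hsuf
  · -- `i ∉ range q`: prepend `i`.
    have hq' : Function.Injective (Fin.cons i q : Fin (k + 1 + 1) → Fin R) :=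
      Fin.cons_injective_iff.mpr ⟨hi, hq⟩
    have h := hle (Fin.cons i q : Fin (k + 1 + 1) → Fin R) hq'
    rw [Fin.prod_univ_succ] at h
    simp only [Fin.castSucc_zero, Fin.cons_zero, Fin.cons_succ, Fin.castSucc_succ, hq0] at h
    exact (mul_comm _ _).trans_le h

/-- **Stub `stub_cycleBalancing` (max-plus balancing).** If every directed cycle through distinct
vertices of the weighted digraph of `K` (loops included) has `‖∏ K‖ ≤ M ^ length` with `M > 0`,
then a positive diagonal similarity makes every entry small: there is `d > 0` with
`d i * ‖K i j‖ / d j ≤ M` for all `i j`. [folklore] -/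
theorem stub_cycleBalancing :
    ∀ (R : ℕ) (K : Matrix (Fin R) (Fin R) ℂ) (M : ℝ), 0 < M →
      (∀ (n : ℕ) (v : Fin (n + 1) → Fin R), Function.Injective v →
        ‖∏ t : Fin (n + 1), K (v t) (v (t + 1))‖ ≤ M ^ (n + 1)) →
      ∃ d : Fin R → ℝ, (∀ i, 0 < d i) ∧ ∀ i j, d i * ‖K i j‖ / d j ≤ M := by
  intro R K M hM hcyc
  obtain ⟨e, he1, he⟩ := exists_potential (fun i j => ‖K i j‖ / M)
    (fun i j => div_nonneg (norm_nonneg _) hM.le)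
    (fun n v hv => prod_norm_div_cycle_le_one K hM hcyc v hv)
  have he0 : ∀ i, 0 < e i := fun i => one_pos.trans_le (he1 i)
  refine ⟨fun i => (e i)⁻¹, fun i => inv_pos.mpr (he0 i), fun i j => ?_⟩
  have h := he i j
  rw [mul_div_assoc', div_le_iff₀ hM] at h
  rw [div_inv_eq_mul, mul_assoc, inv_mul_le_iff₀ (he0 i)]
  exact (mul_comm _ _).trans_le h

end Summit.ValiantsHypothesis.ValiantsHypothesis.Theorems.PriceOfContractivity.CycleBalancing
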